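import Mathlib
import Summits.NavierStokesRegularity.NavierStokesRegularity.Theorems.EulerZoomLiouvillePowerGaugeEulerLiouvilleHoopRunTools
import Summits.NavierStokesRegularity.NavierStokesRegularity.Theorems.EulerZoomLiouvillePowerGaugeEulerLiouvilleHoopRunContradiction
import Summits.NavierStokesRegularity.NavierStokesRegularity.Theorems.EulerZoomLiouvillePowerGaugeEulerLiouvilleHoopNetPressureDrop
import HarnessLib

/-!
# Hoop core — K-TJ″ (alt 8′) (M0′): ONE straight, THIN-WALLED, slow ∧ Bernoulli-high run with quiet END DISCS against the E-TAIL is contradictory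

Sub-problem `NavierStokesRegularity`, crux `PowerGaugeEulerLiouville` (a crux CLASS of self-similar Euler/NS strata on the
MODEL lattice — not NS regularity, not E).  Seat ns-ezl-w3 g7 (alt 8′ file (M0′); LEAD 19832 ns-typeII-p2 g15 keys 04:09:19Z/04:16:26Z;
face `HasStraightSlowHighRunsFree` and bookkeeping = nsreg-p2 g40 ROUND-50 §1/§3, `r50/TJfree_Q.lean`).

`false_of_straightSlowHighRunFree` — profile level.  Relative to alt 8's `HoopCore.false_of_straightSlowHighRun` (`…HoopRunContradiction`):
(i) the Dirichlet energy of the moved cylinder is bounded by the SHELL E-TAIL `∫⁻_{R ≤ ‖y‖ ≤ 2R} ‖DV‖ₑ² ≤ ε·R^{1−ρ}` (no budget constant);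
(ii) the speed bound `‖V‖ ≤ K R` is assumed on the two END DISCS `{x₂ = s₁, s₂}` only (no interior / wall speed clause) — the end
fluxes, `endTermC`, `offsetTerm` and the disc masses all live there; (iii) the wall term is paid by energy through the LATERAL HOOP
INEQUALITY instance for the moved field (a hypothesis here; the LEAD's t53-LEL `lateralHoopInequality` discharges it), via the NET law
`integral_axisPressureDrop_le_of_lateral` (`…HoopNetPressureDrop`).  Constraint: `4K² + 4K < Λ·(½γ(1−γ) − ½λ² − η)` and `R` large in the
sense `ε + 2K·R^{−(2+ρ)} ≤ (Λ(½γ(1−γ) − ½λ² − η) − (4K² + 4K))/2`.  Bookkeeping (÷2πR²b, b = R^{−(1+ρ)}): `2E_Z ≤ 6εR²b`, ends `2·2πbK²R²`,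
`[endTermC] ≤ 2π·2b(K+2γ)KR²`, `[offsetTerm] ≤ 2π·4γbKR²`, `2πγ[dm] ≤ 4πγKRb²`, `2π(1−3γ)∫[dm]/t ≤ 2πKRb²`; `3/π ≤ 1`, `8γ ≤ 4`, `2γ ≤ 1`.
WHAT THIS IS NOT: not NS, not E — a statement about hypothetical profiles; 19832 OPEN; NS regularity NOT proved.  [nsreg-p2 g40 ROUND-50 §3; HOOP NOTE §10(a)]
-/

noncomputable section

open MeasureTheory Set WithLp Metric Real Function
open scoped InnerProductSpace RealInnerProductSpace ENNReal Interval

set_option linter.dupNamespace false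

namespace Summit.NavierStokesRegularity.NavierStokesRegularity.Theorems.PowerGaugeEulerLiouville.HoopCore

open Literature.Analysis Literature.Analysis.FluidPDE

variable {V : EuclideanSpace ℝ (Fin 3) → EuclideanSpace ℝ (Fin 3)}

/-- **Frobenius energy of a moved cylinder inside a measurable bounded TARGET SET**: if `g x = A x + a` maps `solidCyl s₁ s₂ T₀` into `S`
(`S` bounded), then `∫_{solidCyl} |D(A⁻¹∘V∘g)|_F² ≤ ∫_S |DV|_F²` (`V ∈ C¹`). [folklore] -/
theorem setIntegral_frobeniusNormSq_rigid_le_of_mapsTo (hV : ContDiff ℝ 1 V) (A : EuclideanSpace ℝ (Fin 3) ≃ₗᵢ[ℝ] EuclideanSpace ℝ (Fin 3))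
    (a : EuclideanSpace ℝ (Fin 3)) {s₁ s₂ T₀ : ℝ} {S : Set (EuclideanSpace ℝ (Fin 3))} (hSb : Bornology.IsBounded S)
    (hsub : ∀ x ∈ solidCyl s₁ s₂ T₀, A x + a ∈ S) :
    ∫ x in solidCyl s₁ s₂ T₀, frobeniusNormSq (fderiv ℝ (fun y => A.symm (V (A y + a))) x)
      ≤ ∫ y in S, frobeniusNormSq (fderiv ℝ V y) := by
  have hc := continuous_frobeniusNormSq_fderiv hV
  simp_rw [frobeniusNormSq_fderiv_rigid V A a]
  rw [← (measurePreserving_rigid A a).setIntegral_image_emb (measurableEmbedding_rigid A a)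
    (fun y => frobeniusNormSq (fderiv ℝ V y)) (solidCyl s₁ s₂ T₀)]
  have hiS : IntegrableOn (fun y => frobeniusNormSq (fderiv ℝ V y)) S :=
    (hc.continuousOn.integrableOn_compact hSb.isCompact_closure).mono_set subset_closure
  refine setIntegral_mono_set hiS (Filter.Eventually.of_forall fun y => frobeniusNormSq_nonneg _) (Filter.Eventually.of_forall ?_)
  rintro y ⟨x, hx, rfl⟩
  exact hsub x hx

/-- **Frobenius energy of a bounded measurable set from the operator-norm budget**: `∫⁻_S ‖DV‖ₑ² ≤ B` (`B ≥ 0`, `V ∈ C¹`) gives `∫_S |DV|_F² ≤ 3B`. [folklore] -/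
theorem setIntegral_frobeniusNormSq_le_of_lintegral (hV : ContDiff ℝ 1 V) {S : Set (EuclideanSpace ℝ (Fin 3))} (hS : MeasurableSet S)
    (hSb : Bornology.IsBounded S) {B : ℝ} (hB : 0 ≤ B) (hE : ∫⁻ z in S, ‖fderiv ℝ V z‖ₑ ^ 2 ≤ ENNReal.ofReal B) :
    ∫ y in S, frobeniusNormSq (fderiv ℝ V y) ≤ 3 * B := by
  have hcF := continuous_frobeniusNormSq_fderiv hV
  have hcn : Continuous fun y => ‖fderiv ℝ V y‖ ^ 2 := ((hV.continuous_fderiv one_ne_zero).norm).pow 2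
  have hK : IsCompact (closure S) := hSb.isCompact_closure
  have hiF : IntegrableOn (fun y => frobeniusNormSq (fderiv ℝ V y)) S := (hcF.continuousOn.integrableOn_compact hK).mono_set subset_closure
  have hin : IntegrableOn (fun y => ‖fderiv ℝ V y‖ ^ 2) S := (hcn.continuousOn.integrableOn_compact hK).mono_set subset_closure
  have h1 : ∫ y in S, ‖fderiv ℝ V y‖ ^ 2 ≤ B := by
    rw [integral_eq_lintegral_of_nonneg_ae (Filter.Eventually.of_forall fun y => sq_nonneg _) hin.aestronglyMeasurable]
    refine ENNReal.toReal_le_of_le_ofReal hB (le_trans (le_of_eq ?_) hE)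
    refine lintegral_congr fun y => ?_
    rw [← ofReal_norm, ENNReal.ofReal_pow (norm_nonneg _)]
  calc ∫ y in S, frobeniusNormSq (fderiv ℝ V y)
      ≤ ∫ y in S, 3 * ‖fderiv ℝ V y‖ ^ 2 :=
        setIntegral_mono_on hiF (hin.const_mul 3) hS fun y _ => BradshawTsai2017.frobeniusNormSq_le_three_mul_norm_sq _
    _ = 3 * ∫ y in S, ‖fderiv ℝ V y‖ ^ 2 := integral_const_mul _ _
    _ ≤ 3 * B := by linarith

/-- **Disc mass under an end-disc speed bound**: if `‖V(axisPt σ τ θ)‖ ≤ M` for `0 < τ ≤ T` then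
`|∫₀^t τ⟨V_z⟩_θ(σ,τ) dτ| ≤ M·t²` for `0 ≤ t ≤ T` (crude: `τ ≤ t`). [folklore] -/
theorem abs_discMass_le {σ T M : ℝ} (hM : ∀ τ ∈ Ioc 0 T, ∀ θ : ℝ, ‖V (axisPt σ τ θ)‖ ≤ M) {t : ℝ} (ht : t ∈ Icc 0 T) :
    |∫ τ in (0 : ℝ)..t, τ * circleAvg (axialVelocity V) σ τ| ≤ M * t ^ 2 := by
  have h := intervalIntegral.norm_integral_le_of_norm_le_const (a := 0) (b := t) (C := t * M)
    (f := fun τ => τ * circleAvg (axialVelocity V) σ τ) fun τ hτ => by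
      rw [uIoc_of_le ht.1] at hτ
      have hM0 : 0 ≤ M := (norm_nonneg _).trans (hM τ ⟨hτ.1, hτ.2.trans ht.2⟩ 0)
      rw [Real.norm_eq_abs, abs_mul, abs_of_pos hτ.1]
      exact mul_le_mul hτ.2 (abs_circleAvg_le fun θ => (abs_axialVelocity_le V _).trans (hM τ ⟨hτ.1, hτ.2.trans ht.2⟩ θ))
        (abs_nonneg _) ht.1
  rw [Real.norm_eq_abs, sub_zero, abs_of_nonneg ht.1] at h
  calc |∫ τ in (0 : ℝ)..t, τ * circleAvg (axialVelocity V) σ τ| ≤ t * M * t := h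
    _ = M * t ^ 2 := by ring

/-- **K-TJ″ (alt 8′, M0′) — ONE LONG STRAIGHT THIN-WALLED SLOW ∧ HIGH RUN WITH QUIET END DISCS CONTRADICTS THE E-TAIL.**
See the module docstring for the data; the conclusion is `False`.  [nsreg-p2 g40 ROUND-50 §3; ns-idea-11 g8 HOOP NOTE §10(a)] -/
theorem false_of_straightSlowHighRunFree {ρ : ℝ} (hρ : 0 < ρ) (hρ1 : ρ ≤ 1 / 2)
    {V : EuclideanSpace ℝ (Fin 3) → EuclideanSpace ℝ (Fin 3)} {P : EuclideanSpace ℝ (Fin 3) → ℝ}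
    (hprof : IsSelfSimilarEulerProfile (1 / (2 + ρ)) 0 V P)
    {Λ lam η K ε : ℝ} (hΛ : 0 < Λ) (hK : 0 ≤ K) (hε : 0 ≤ ε)
    (hface : 4 * K ^ 2 + 4 * K < Λ * ((1 / (2 + ρ)) * (1 - 1 / (2 + ρ)) / 2 - lam ^ 2 / 2 - η))
    {A : EuclideanSpace ℝ (Fin 3) ≃ₗᵢ[ℝ] EuclideanSpace ℝ (Fin 3)} {a : EuclideanSpace ℝ (Fin 3)} {R s₁ s₂ h : ℝ} (hR : 1 ≤ R)
    (hlen : s₁ + Λ * R ^ (-(1 + ρ)) ≤ s₂)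
    (htube : ∀ x ∈ solidCyl s₁ s₂ (R ^ (-(1 + ρ))),
      R ≤ ‖A x + a‖ ∧ ‖A x + a‖ ≤ 2 * R ∧ ((x 2 = s₁ ∨ x 2 = s₂) → ‖V (A x + a)‖ ≤ K * R))
    (haxis : ∀ σ ∈ Icc s₁ s₂, ‖selfSimilarTransport (1 / (2 + ρ)) 0 V (A (σ • eZ) + a)‖ ≤ lam * R ∧
        h ≤ selfSimilarBernoulli (1 / (2 + ρ)) 0 V P (A (σ • eZ) + a) ∧
        circleAvg (fun x => P (A x + a)) σ (R ^ (-(1 + ρ))) ≤ h + η * R ^ 2)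
    (hE : ∫⁻ z in Metric.closedBall (0 : EuclideanSpace ℝ (Fin 3)) (2 * R) \ Metric.ball (0 : EuclideanSpace ℝ (Fin 3)) R,
        ‖fderiv ℝ V z‖ₑ ^ 2 ≤ ENNReal.ofReal (ε * R ^ (1 - ρ)))
    (hlat : (∫ y in solidCyl s₁ s₂ (R ^ (-(1 + ρ))), hoopDensity (fun y => A.symm (V (A y + a))) y)
        + 2 * Real.pi * (∫ σ in s₁..s₂, circleAvg (fun y => radialVelocity (fun y => A.symm (V (A y + a))) y ^ 2) σ (R ^ (-(1 + ρ))))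
      ≤ 2 * (∫ y in solidCyl s₁ s₂ (R ^ (-(1 + ρ))), frobeniusNormSq (fderiv ℝ (fun y => A.symm (V (A y + a))) y))
        + Real.pi * (∫ σ in s₁..s₂, (‖(fun y => A.symm (V (A y + a))) (σ • eZ)‖ ^ 2
            - (axialVelocity (fun y => A.symm (V (A y + a))) (σ • eZ)) ^ 2))
        + endFlux (fun y => A.symm (V (A y + a))) s₁ (R ^ (-(1 + ρ))) + endFlux (fun y => A.symm (V (A y + a))) s₂ (R ^ (-(1 + ρ))))
    (hsmall : ε + 2 * K * R ^ (-(2 + ρ)) ≤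
        (Λ * ((1 / (2 + ρ)) * (1 - 1 / (2 + ρ)) / 2 - lam ^ 2 / 2 - η) - (4 * K ^ 2 + 4 * K)) / 2) :
    False := by
  -- ### scalars
  set γ : ℝ := 1 / (2 + ρ) with hγdef
  have h2ρ : (0 : ℝ) < 2 + ρ := by linarith
  have hγ0 : 0 < γ := one_div_pos.2 h2ρ
  have hγhalf : γ ≤ 1 / 2 := by rw [hγdef, div_le_div_iff₀ h2ρ two_pos]; linarith
  have hγ1 : 0 ≤ 1 - γ := by linarith
  have h13 : |1 - 3 * γ| ≤ 1 / 2 := abs_one_sub_three_mul_le hρ.le hρ1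
  have hR0 : 0 < R := by linarith
  set b : ℝ := R ^ (-(1 + ρ)) with hbdef
  have hb : 0 < b := Real.rpow_pos_of_pos hR0 _
  have hbR : b = R ^ (-(2 + ρ)) * R := by
    rw [hbdef, show -(1 + ρ) = -(2 + ρ) + 1 by ring, Real.rpow_add hR0, Real.rpow_one]
  have hR1ρ : R ^ (1 - ρ) = R ^ 2 * b := by
    rw [hbdef, show (1 - ρ) = (2 : ℝ) + (-(1 + ρ)) by ring, Real.rpow_add hR0, Real.rpow_two]
  set L : ℝ := s₂ - s₁ with hLdef
  have hLΛ : Λ * b ≤ L := by rw [hLdef]; linarith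
  have hL : 0 < L := lt_of_lt_of_le (mul_pos hΛ hb) hLΛ
  have hs : s₁ < s₂ := by rw [hLdef] at hL; linarith
  -- ### the moved pair
  set V' : EuclideanSpace ℝ (Fin 3) → EuclideanSpace ℝ (Fin 3) := fun y => A.symm (V (A y + a)) with hV'def
  set P' : EuclideanSpace ℝ (Fin 3) → ℝ := fun y => P (A y + a) with hP'def
  set c' : EuclideanSpace ℝ (Fin 3) := A.symm (-a) with hc'def
  have hprof' : IsSelfSimilarEulerProfile γ c' V' P' := isSelfSimilarEulerProfile_rigid hprof A a
  have hV1 : ContDiff ℝ 1 V := hprof.contDiff_velocity.of_le (by norm_num)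
  have hV'c : Continuous V' := hprof'.contDiff_velocity.continuous
  have hP'c : Continuous P' := hprof'.contDiff_pressure.continuous
  have hnV' : ∀ x, ‖V' x‖ = ‖V (A x + a)‖ := fun x => by rw [hV'def]; exact A.symm.norm_map _
  have hmem : ∀ σ ∈ Icc s₁ s₂, ∀ t ∈ Ioc 0 b, ∀ θ : ℝ, axisPt σ t θ ∈ solidCyl s₁ s₂ b :=
    fun σ hσ t ht θ => (axisPt_mem_solidCyl ht.1.le θ).2 ⟨hσ.1, hσ.2, ht.2⟩
  -- speed on the two END DISCS, for the moved field
  have hend : ∀ s : ℝ, (s = s₁ ∨ s = s₂) → ∀ t ∈ Ioc 0 b, ∀ θ : ℝ, ‖V' (axisPt s t θ)‖ ≤ K * R := by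
    intro s hsI t ht θ
    have hsIcc : s ∈ Icc s₁ s₂ := by rcases hsI with rfl | rfl <;> [exact ⟨le_rfl, hs.le⟩; exact ⟨hs.le, le_rfl⟩]
    have hx := hmem s hsIcc t ht θ
    rw [hnV']
    refine (htube _ hx).2.2 ?_
    rw [(axisPt_apply s t θ).2.2]; exact hsI
  have hKR : 0 ≤ K * R := by positivity
  -- ### the NET law for the moved pair
  have h0 := integral_axisPressureDrop_le_of_lateral hprof' hs hb hlat
  -- ### (1) the left side: the ridge
  have hI : L * (((γ * (1 - γ)) / 2 - lam ^ 2 / 2 - η) * R ^ 2) ≤ ∫ σ in s₁..s₂, (P' (σ • eZ) - circleAvg P' σ b) := by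
    have hpt : ∀ σ ∈ Icc s₁ s₂, ((γ * (1 - γ)) / 2 - lam ^ 2 / 2 - η) * R ^ 2 ≤ P' (σ • eZ) - circleAvg P' σ b := by
      intro σ hσ
      obtain ⟨hW, hH, hAmb⟩ := haxis σ hσ
      obtain ⟨hRle, -, -⟩ := htube (σ • eZ) (smul_eZ_mem_solidCyl hσ hb.le)
      rw [selfSimilarTransport_apply, sub_zero] at hW
      simp only [selfSimilarBernoulli_apply, sub_zero] at hH
      have hW2 : ‖γ • (A (σ • eZ) + a) + V (A (σ • eZ) + a)‖ ^ 2 ≤ (lam * R) ^ 2 :=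
        pow_le_pow_left₀ (norm_nonneg _) hW 2
      have hy2 : R ^ 2 ≤ ‖A (σ • eZ) + a‖ ^ 2 := pow_le_pow_left₀ hR0.le hRle 2
      have hP : P' (σ • eZ) = P (A (σ • eZ) + a) := rfl
      rw [hP]
      have hγγ : 0 ≤ γ * (1 - γ) := mul_nonneg hγ0.le hγ1
      have hprod : γ * (1 - γ) * R ^ 2 ≤ γ * (1 - γ) * ‖A (σ • eZ) + a‖ ^ 2 := mul_le_mul_of_nonneg_left hy2 hγγ
      linarith only [hH, hAmb, hW2, hprod]
    have hcont : Continuous fun σ : ℝ => P' (σ • eZ) - circleAvg P' σ b :=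
      (hP'c.comp (continuous_id.smul continuous_const)).sub (continuous_circleAvg_height hP'c b)
    have hm := intervalIntegral.integral_mono_on hs.le (intervalIntegrable_const (μ := volume)) (hcont.intervalIntegrable _ _) hpt
    rwa [intervalIntegral.integral_const, smul_eq_mul, show (s₂ - s₁) = L from rfl] at hm
  -- ### (2) the Dirichlet energy of the moved cylinder from the SHELL tail
  have hEZ : ∫ x in solidCyl s₁ s₂ b, frobeniusNormSq (fderiv ℝ V' x) ≤ 3 * ε * (R ^ 2 * b) := by
    have hSm : MeasurableSet (Metric.closedBall (0 : EuclideanSpace ℝ (Fin 3)) (2 * R) \ Metric.ball (0 : EuclideanSpace ℝ (Fin 3)) R) :=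
      measurableSet_closedBall.diff measurableSet_ball
    have hSb : Bornology.IsBounded (Metric.closedBall (0 : EuclideanSpace ℝ (Fin 3)) (2 * R) \ Metric.ball (0 : EuclideanSpace ℝ (Fin 3)) R) :=
      Metric.isBounded_closedBall.subset fun _ hx => hx.1
    have h1 := setIntegral_frobeniusNormSq_rigid_le_of_mapsTo hV1 A a (s₁ := s₁) (s₂ := s₂) (T₀ := b) hSb
      (fun x hx => ⟨mem_closedBall_zero_iff.2 (htube x hx).2.1, fun hb' => (not_le.2 (mem_ball_zero_iff.1 hb')) (htube x hx).1⟩)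
    have h2 := setIntegral_frobeniusNormSq_le_of_lintegral hV1 hSm hSb (by positivity : (0 : ℝ) ≤ ε * R ^ (1 - ρ)) hE
    rw [hR1ρ] at h2
    linarith only [h1, h2]
  -- ### (3) the end fluxes
  have heF₁ : endFlux V' s₁ b ≤ 2 * Real.pi * b * (K * R) ^ 2 := endFlux_le_of_norm_le hV'c s₁ hb (hend s₁ (Or.inl rfl))
  have heF₂ : endFlux V' s₂ b ≤ 2 * Real.pi * b * (K * R) ^ 2 := endFlux_le_of_norm_le hV'c s₂ hb (hend s₂ (Or.inr rfl))
  -- ### (4) the disc masses (end discs only)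
  have hdm : ∀ s : ℝ, (s = s₁ ∨ s = s₂) → ∀ t ∈ Icc 0 b,
      |∫ τ in (0 : ℝ)..t, τ * circleAvg (axialVelocity V') s τ| ≤ K * R * t ^ 2 :=
    fun s hsI t ht => abs_discMass_le (V := V') (hend s hsI) ht
  have hdmb := abs_le.1 (hdm s₁ (Or.inl rfl) b ⟨hb.le, le_rfl⟩)
  have hdmb' := abs_le.1 (hdm s₂ (Or.inr rfl) b ⟨hb.le, le_rfl⟩)
  have hM1 : γ * ((∫ τ in (0 : ℝ)..b, τ * circleAvg (axialVelocity V') s₁ τ) - (∫ τ in (0 : ℝ)..b, τ * circleAvg (axialVelocity V') s₂ τ))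
      ≤ γ * (2 * (K * R * b ^ 2)) :=
    mul_le_mul_of_nonneg_left (by linarith only [hdmb.2, hdmb'.1]) hγ0.le
  have hM2abs : |∫ t in (0 : ℝ)..b, ((∫ τ in (0 : ℝ)..t, τ * circleAvg (axialVelocity V') s₁ τ)
      - (∫ τ in (0 : ℝ)..t, τ * circleAvg (axialVelocity V') s₂ τ)) / t| ≤ 2 * (K * R * b) * b := by
    have h := intervalIntegral.norm_integral_le_of_norm_le_const (a := 0) (b := b) (C := 2 * (K * R * b))
      (f := fun t => ((∫ τ in (0 : ℝ)..t, τ * circleAvg (axialVelocity V') s₁ τ)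
        - (∫ τ in (0 : ℝ)..t, τ * circleAvg (axialVelocity V') s₂ τ)) / t) fun t ht => by
        rw [uIoc_of_le hb.le] at ht
        have ht' : t ∈ Icc 0 b := ⟨ht.1.le, ht.2⟩
        have a1 := hdm s₁ (Or.inl rfl) t ht'
        have a2 := hdm s₂ (Or.inr rfl) t ht'
        rw [Real.norm_eq_abs, abs_div, abs_of_pos ht.1, div_le_iff₀ ht.1]
        calc |(∫ τ in (0 : ℝ)..t, τ * circleAvg (axialVelocity V') s₁ τ) - ∫ τ in (0 : ℝ)..t, τ * circleAvg (axialVelocity V') s₂ τ|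
            ≤ K * R * t ^ 2 + K * R * t ^ 2 := (abs_sub _ _).trans (add_le_add a1 a2)
          _ ≤ 2 * (K * R * b) * t := by
              have hprod := mul_le_mul_of_nonneg_left ht.2 (mul_nonneg hKR ht.1.le)
              linarith only [hprod]
    rwa [Real.norm_eq_abs, sub_zero, abs_of_pos hb] at h
  have hM2 : (1 - 3 * γ) * (∫ t in (0 : ℝ)..b, ((∫ τ in (0 : ℝ)..t, τ * circleAvg (axialVelocity V') s₁ τ)
      - (∫ τ in (0 : ℝ)..t, τ * circleAvg (axialVelocity V') s₂ τ)) / t) ≤ 1 / 2 * (2 * (K * R * b) * b) :=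
    calc (1 - 3 * γ) * (∫ t in (0 : ℝ)..b, ((∫ τ in (0 : ℝ)..t, τ * circleAvg (axialVelocity V') s₁ τ)
          - (∫ τ in (0 : ℝ)..t, τ * circleAvg (axialVelocity V') s₂ τ)) / t)
        ≤ |(1 - 3 * γ) * (∫ t in (0 : ℝ)..b, ((∫ τ in (0 : ℝ)..t, τ * circleAvg (axialVelocity V') s₁ τ)
          - (∫ τ in (0 : ℝ)..t, τ * circleAvg (axialVelocity V') s₂ τ)) / t)| := le_abs_self _
      _ = |1 - 3 * γ| * |∫ t in (0 : ℝ)..b, ((∫ τ in (0 : ℝ)..t, τ * circleAvg (axialVelocity V') s₁ τ)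
          - (∫ τ in (0 : ℝ)..t, τ * circleAvg (axialVelocity V') s₂ τ)) / t| := abs_mul _ _
      _ ≤ 1 / 2 * (2 * (K * R * b) * b) := mul_le_mul h13 hM2abs (abs_nonneg _) (by norm_num)
  -- ### (5) the end functionals (end discs only)
  have htransport : ∀ s : ℝ, (s = s₁ ∨ s = s₂) → ∀ t ∈ Ioc 0 b, ∀ θ : ℝ,
      |γ * ((axisPt s t θ) 2 - c' 2) + axialVelocity V' (axisPt s t θ)| ≤ (K + 2 * γ) * R := by
    intro s hsI t ht θ
    have hsIcc : s ∈ Icc s₁ s₂ := by rcases hsI with rfl | rfl <;> [exact ⟨le_rfl, hs.le⟩; exact ⟨hs.le, le_rfl⟩]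
    have hx := hmem s hsIcc t ht θ
    obtain ⟨-, hx2, -⟩ := htube _ hx
    have hxV : ‖V (A (axisPt s t θ) + a)‖ ≤ K * R := by rw [← hnV']; exact hend s hsI t ht θ
    have e : γ * ((axisPt s t θ) 2 - c' 2) + axialVelocity V' (axisPt s t θ) = (γ • (axisPt s t θ - c') + V' (axisPt s t θ)) 2 := by
      simp only [axialVelocity, PiLp.add_apply, PiLp.smul_apply, PiLp.sub_apply, smul_eq_mul]
    rw [e]
    calc |(γ • (axisPt s t θ - c') + V' (axisPt s t θ)) 2| ≤ ‖γ • (axisPt s t θ - c') + V' (axisPt s t θ)‖ := by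
          simpa only [Real.norm_eq_abs] using PiLp.norm_apply_le (γ • (axisPt s t θ - c') + V' (axisPt s t θ)) 2
      _ = ‖γ • (A (axisPt s t θ) + a) + V (A (axisPt s t θ) + a)‖ := by rw [hV'def, hc'def]; exact norm_transport_rigid γ A a _
      _ ≤ ‖γ • (A (axisPt s t θ) + a)‖ + ‖V (A (axisPt s t θ) + a)‖ := norm_add_le _ _
      _ ≤ γ * (2 * R) + K * R := by rw [norm_smul, Real.norm_eq_abs, abs_of_pos hγ0]; gcongr
      _ = (K + 2 * γ) * R := by ring
  have hEnd : ∀ s : ℝ, (s = s₁ ∨ s = s₂) → |endTermC γ c' V' b s| ≤ b * ((K + 2 * γ) * R * (K * R)) := by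
    intro s hsI
    refine abs_endTermC_le hb.le s fun t ht θ => ?_
    rw [abs_mul]
    exact mul_le_mul (htransport s hsI t ht θ) ((abs_radialVelocity_le V' _).trans (hend s hsI t ht θ)) (abs_nonneg _) (by positivity)
  have hOff : ∀ s : ℝ, (s = s₁ ∨ s = s₂) → |offsetTerm γ c' V' b s| ≤ |γ| * b * (2 * R * (K * R)) := by
    intro s hsI
    have hsIcc : s ∈ Icc s₁ s₂ := by rcases hsI with rfl | rfl <;> [exact ⟨le_rfl, hs.le⟩; exact ⟨hs.le, le_rfl⟩]
    refine abs_offsetTerm_le hb.le s fun t ht θ => ?_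
    rw [abs_mul, ← inner_eR_eq_components c' (axisPt s t θ), abs_neg]
    have hz : ⟪(eZ : EuclideanSpace ℝ (Fin 3)), eR (axisPt s t θ)⟫ = 0 := (frame_orthonormal_axisPt s ht.1 θ).2.2.2.1
    have hc : ⟪c', eR (axisPt s t θ)⟫ = ⟪c' - s • eZ, eR (axisPt s t θ)⟫ := by
      rw [inner_sub_left, inner_smul_left, hz]; simp
    have hc2 : |⟪c', eR (axisPt s t θ)⟫| ≤ 2 * R := by
      rw [hc]
      calc |⟪c' - s • eZ, eR (axisPt s t θ)⟫| ≤ ‖c' - s • eZ‖ := abs_inner_eR_le _ _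
        _ = ‖A (s • eZ) + a‖ := by rw [norm_sub_rev, hc'def]; exact norm_sub_centre_rigid A a (s • eZ)
        _ ≤ 2 * R := (htube (s • eZ) (smul_eZ_mem_solidCyl hsIcc hb.le)).2.1
    exact mul_le_mul hc2 ((abs_axialVelocity_le V' _).trans (hend s hsI t ht θ)) (abs_nonneg _) (by positivity)
  have hEnd₁ := abs_le.1 (hEnd s₁ (Or.inl rfl))
  have hEnd₂ := abs_le.1 (hEnd s₂ (Or.inr rfl))
  have hOff₁ := hOff s₁ (Or.inl rfl)
  have hOff₂ := hOff s₂ (Or.inr rfl)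
  rw [abs_of_pos hγ0] at hOff₁ hOff₂
  have hOff₁' := abs_le.1 hOff₁
  have hOff₂' := abs_le.1 hOff₂
  -- ### (6) assemble: the undivided inequality
  have h2π : (0 : ℝ) ≤ 2 * Real.pi := by positivity
  have hI2 := mul_le_mul_of_nonneg_left hI h2π
  have hM1' := mul_le_mul_of_nonneg_left hM1 h2π
  have hM2' := mul_le_mul_of_nonneg_left hM2 h2π
  have hEnds : (endTermC γ c' V' b s₂ - endTermC γ c' V' b s₁) ≤ 2 * (b * ((K + 2 * γ) * R * (K * R))) := by
    linarith only [hEnd₁.1, hEnd₂.2]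
  have hOffs : -(offsetTerm γ c' V' b s₂ - offsetTerm γ c' V' b s₁) ≤ 2 * (γ * b * (2 * R * (K * R))) := by
    linarith only [hOff₁'.2, hOff₂'.1]
  have hEnds' := mul_le_mul_of_nonneg_left hEnds h2π
  have hOffs' := mul_le_mul_of_nonneg_left hOffs h2π
  have hsum : 2 * Real.pi * (L * (((γ * (1 - γ)) / 2 - lam ^ 2 / 2 - η) * R ^ 2)) ≤
      2 * (3 * ε * (R ^ 2 * b)) + 2 * (2 * Real.pi * b * (K * R) ^ 2) + 2 * Real.pi * (γ * (2 * (K * R * b ^ 2)))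
        + 2 * Real.pi * (1 / 2 * (2 * (K * R * b) * b))
        + 2 * Real.pi * (2 * (b * ((K + 2 * γ) * R * (K * R)))) + 2 * Real.pi * (2 * (γ * b * (2 * R * (K * R)))) := by
    have e1 : 2 * Real.pi * γ * ((∫ τ in (0 : ℝ)..b, τ * circleAvg (axialVelocity V') s₁ τ)
        - (∫ τ in (0 : ℝ)..b, τ * circleAvg (axialVelocity V') s₂ τ)) =
        2 * Real.pi * (γ * ((∫ τ in (0 : ℝ)..b, τ * circleAvg (axialVelocity V') s₁ τ)
        - (∫ τ in (0 : ℝ)..b, τ * circleAvg (axialVelocity V') s₂ τ))) := by ring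
    have e2 : 2 * Real.pi * (1 - 3 * γ) * (∫ t in (0 : ℝ)..b, ((∫ τ in (0 : ℝ)..t, τ * circleAvg (axialVelocity V') s₁ τ)
        - (∫ τ in (0 : ℝ)..t, τ * circleAvg (axialVelocity V') s₂ τ)) / t) =
        2 * Real.pi * ((1 - 3 * γ) * (∫ t in (0 : ℝ)..b, ((∫ τ in (0 : ℝ)..t, τ * circleAvg (axialVelocity V') s₁ τ)
        - (∫ τ in (0 : ℝ)..t, τ * circleAvg (axialVelocity V') s₂ τ)) / t)) := by ring
    rw [e1, e2] at h0
    linarith only [h0, hI2, hEZ, heF₁, heF₂, hM1', hM2', hEnds', hOffs']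
  -- ### (7) divide by `2πR²b` and conclude
  set X : ℝ := L / b with hXdef
  have hLX : L = X * b := by rw [hXdef]; field_simp
  have hXΛ : Λ ≤ X := by rw [hXdef, le_div_iff₀ hb]; exact hLΛ
  have hbdivR : b / R = R ^ (-(2 + ρ)) := by rw [hbR, mul_div_cancel_right₀ _ hR0.ne']
  have hπ : 0 < Real.pi := Real.pi_pos
  have hdiv0 : X * ((γ * (1 - γ)) / 2 - lam ^ 2 / 2 - η) ≤
      3 / Real.pi * ε + 4 * K ^ 2 + 8 * γ * K + (2 * γ + 1) * K * (b / R) := by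
    have hD : 0 < 2 * Real.pi * (R ^ 2 * b) := by positivity
    rw [hLX] at hsum
    have e1 : 2 * Real.pi * (X * b * (((γ * (1 - γ)) / 2 - lam ^ 2 / 2 - η) * R ^ 2)) =
        2 * Real.pi * (R ^ 2 * b) * (X * ((γ * (1 - γ)) / 2 - lam ^ 2 / 2 - η)) := by ring
    have e2 : 2 * (3 * ε * (R ^ 2 * b)) + 2 * (2 * Real.pi * b * (K * R) ^ 2) + 2 * Real.pi * (γ * (2 * (K * R * b ^ 2)))
        + 2 * Real.pi * (1 / 2 * (2 * (K * R * b) * b))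
        + 2 * Real.pi * (2 * (b * ((K + 2 * γ) * R * (K * R)))) + 2 * Real.pi * (2 * (γ * b * (2 * R * (K * R)))) =
        2 * Real.pi * (R ^ 2 * b) * (3 / Real.pi * ε + 4 * K ^ 2 + 8 * γ * K + (2 * γ + 1) * K * (b / R)) := by
      field_simp
      ring
    rw [e1, e2] at hsum
    exact le_of_mul_le_mul_left hsum hD
  have h3π : 3 / Real.pi * ε ≤ ε := by
    have h31 : 3 / Real.pi ≤ 1 := by rw [div_le_one hπ]; exact Real.pi_gt_three.le
    have := mul_le_mul_of_nonneg_right h31 hε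
    linarith only [this]
  have h8γ : 8 * γ * K ≤ 4 * K := by
    have := mul_le_mul_of_nonneg_right hγhalf hK
    linarith only [this]
  have hdiv : X * ((γ * (1 - γ)) / 2 - lam ^ 2 / 2 - η) ≤
      3 / Real.pi * ε + 4 * K ^ 2 + 8 * γ * K + (2 * γ + 1) * K * R ^ (-(2 + ρ)) := by
    rw [← hbdivR]; exact hdiv0
  have hKb : (2 * γ + 1) * K * R ^ (-(2 + ρ)) ≤ 2 * K * R ^ (-(2 + ρ)) := by
    have hr0 : 0 ≤ R ^ (-(2 + ρ)) := Real.rpow_nonneg hR0.le _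
    have h2 : (2 * γ + 1) * K ≤ 2 * K := by
      have := mul_le_mul_of_nonneg_right hγhalf hK
      linarith only [this]
    exact mul_le_mul_of_nonneg_right h2 hr0
  have hX : X * ((γ * (1 - γ)) / 2 - lam ^ 2 / 2 - η) ≤ 4 * K ^ 2 + 4 * K + (ε + 2 * K * R ^ (-(2 + ρ))) := by
    linarith only [hdiv, h3π, h8γ, hKb]
  have hS0 : 0 ≤ 4 * K ^ 2 + 4 * K := by positivity
  have hface' : 4 * K ^ 2 + 4 * K < Λ * (γ * (1 - γ) / 2 - lam ^ 2 / 2 - η) := by simpa only [hγdef] using hface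
  have hsmall' : ε + 2 * K * R ^ (-(2 + ρ)) ≤ (Λ * (γ * (1 - γ) / 2 - lam ^ 2 / 2 - η) - (4 * K ^ 2 + 4 * K)) / 2 := by
    simpa only [hγdef] using hsmall
  have hμ : 0 < (γ * (1 - γ)) / 2 - lam ^ 2 / 2 - η := by
    by_contra hneg
    have : Λ * (γ * (1 - γ) / 2 - lam ^ 2 / 2 - η) ≤ 0 := mul_nonpos_iff.2 (Or.inl ⟨hΛ.le, not_lt.1 hneg⟩)
    linarith only [this, hface', hS0]
  have hΛle : Λ * ((γ * (1 - γ)) / 2 - lam ^ 2 / 2 - η) ≤ 4 * K ^ 2 + 4 * K + (ε + 2 * K * R ^ (-(2 + ρ))) :=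
    (mul_le_mul_of_nonneg_right hXΛ hμ.le).trans hX
  linarith only [hΛle, hface', hsmall', hε]

end Summit.NavierStokesRegularity.NavierStokesRegularity.Theorems.PowerGaugeEulerLiouville.HoopCore

end
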